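import Summits.ValiantsHypothesis.ValiantsHypothesis.Theorems.KPlusLogSqLawTropicalExchange

/-!
# Route «KPlusLogSqLaw» — structure lemma: LAYER-BOUNDARY RIGIDITY (pure later terms re-row everything they touch)

HONEST FRAMING.  Helper file (cell `pub-symmetroid`, seat val-sym-lift-p3 g5, 2026-08-27) toward the crux
`Summit.ValiantsHypothesis.ValiantsHypothesis.Theses.KPlusLogSqLaw.WeakLifting` (ledger item `stmt-ValiantsHypothesis-19561`;
docket D2 = the `K = 4` tropical exponent fork), in the dominance vocabulary of `…TropicalExchange` (`IsDominant`, admissible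
column sets).  A STRUCTURAL law for pairs of dominant terms of an ARBITRARY design; it proves no stub and asserts nothing about
`TropicalB`, `WeakLifting`, `Lifting`, `KPlusLogSqLaw`, `MatrixDescartes` (stmt-ValiantsHypothesis-18050) or `VP ≠ VNP`.

THE LAW.  Call a term `r = (σ, λ)` PURE over a class `l⋆` (hypothesis `∀ i, λ i = l⋆ ∨ d (λ i) = 0`) when every column carries either the class `l⋆` or a class of exponent `0`
(e.g. the first term `(m−c−1, 0, 0, c+1)` of a layer of a `K = 4` chain with `d = (0, d₁, d₂, d₃)`, `l⋆ = 3`; or the first term of a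
page, `l⋆ = 2`, when the page starts without class-1 entries and `d₁`… — any term using only `{l : d l = 0} ∪ {l⋆}`).  Let `q` be
dominant at `θa` and the pure term `r` dominant at `θb > θa`, and let `C` be a column set ADMISSIBLE for the pair (same row images).
* `topCount_lt_of_swap_pure` — if `q` and `r` differ somewhere on `C`, then `C` carries STRICTLY MORE `l⋆`-entries in `r` than in `q`.
  (Component exchange `sum_lt_sum_of_swap`: `Σ_C d λ_q < Σ_C d λ_r = d l⋆ · #l⋆(r|C)`, while `Σ_C d λ_q ≥ d l⋆ · #l⋆(q|C)`.)
  No lex hypothesis on `d` is needed.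
* `sameRow_eq_or_top_of_pure` — the case `C = {i}` with `σ_q i = σ_r i`: at a shared POSITION the two terms either agree (same class)
  or `r` carries `l⋆` there and `q` does not.  So a pure later term RE-ROWS every column of the earlier term that it neither copies
  nor upgrades to `l⋆`.
* `not_two_disjoint_swaps_of_pure` — if moreover the total `l⋆`-count rises by at most one from `q` to `r`, then there are NO TWO
  DISJOINT admissible column sets on each of which `q` and `r` differ: the difference `q Δ r` is a SINGLE exchange component (plus nothing).
  This is the cell's located «single-cycle rigidity at block boundaries» ((★) of val-sym-lift-p3 g2; READING of `…TropicalExchange`)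
  as a kernel statement free of cycle decompositions: with lex exponents the first term of the next layer/page is pure and gains
  exactly one top entry, hence differs from EVERY term of the previous layer/page in exactly one component, which therefore contains
  all of that term's lower-class columns.
Chain forms: `topCount_lt_of_swap_pure_chain`, `not_two_disjoint_swaps_of_pure_chain`.  [folklore LP/exchange reasoning; packaging = the cell's]
-/

set_option linter.dupNamespace false
set_option autoImplicit false

namespace Summit.ValiantsHypothesis.ValiantsHypothesis.Theorems.LacunarySymmetroidMatrixDescartes.TropicalCensus

open Summit.ValiantsHypothesis.ValiantsHypothesis.Theorems.MatrixDescartes.Negative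
open scoped BigOperators
open Finset

section LayerBoundary

variable {m K : ℕ}

/-- lower bound: the `d`-weight of any term on `C` is at least `d l⋆` times its `l⋆`-count on `C`. [folklore] -/
theorem mul_topCount_le_sum (d : Fin K → ℕ) (lstar : Fin K) (p : Equiv.Perm (Fin m) × (Fin m → Fin K))
    (C : Finset (Fin m)) :
    (d lstar : ℤ) * ((C.filter fun i => p.2 i = lstar).card : ℤ) ≤ ∑ i ∈ C, (d (p.2 i) : ℤ) := by
  classical
  have h1 : (d lstar : ℤ) * ((C.filter fun i => p.2 i = lstar).card : ℤ)
      = ∑ i ∈ C, (if p.2 i = lstar then (d lstar : ℤ) else 0) := by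
    rw [← sum_filter, sum_const, nsmul_eq_mul, mul_comm]
  rw [h1]
  refine sum_le_sum fun i _ => ?_
  by_cases h : p.2 i = lstar
  · rw [if_pos h, h]
  · rw [if_neg h]; exact_mod_cast Nat.zero_le _

/-- for a PURE term the `d`-weight on `C` is exactly `d l⋆` times its `l⋆`-count on `C`. [folklore] -/
theorem sum_eq_mul_topCount_of_pure (d : Fin K → ℕ) (lstar : Fin K) (r : Equiv.Perm (Fin m) × (Fin m → Fin K))
    (hr : ∀ i : Fin m, r.2 i = lstar ∨ d (r.2 i) = 0) (C : Finset (Fin m)) :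
    ∑ i ∈ C, (d (r.2 i) : ℤ) = (d lstar : ℤ) * ((C.filter fun i => r.2 i = lstar).card : ℤ) := by
  classical
  have h1 : (d lstar : ℤ) * ((C.filter fun i => r.2 i = lstar).card : ℤ)
      = ∑ i ∈ C, (if r.2 i = lstar then (d lstar : ℤ) else 0) := by
    rw [← sum_filter, sum_const, nsmul_eq_mul, mul_comm]
  rw [h1]
  refine sum_congr rfl fun i _ => ?_
  by_cases h : r.2 i = lstar
  · rw [if_pos h, h]
  · rw [if_neg h]
    rcases hr i with h' | h'
    · exact absurd h' h
    · exact_mod_cast h'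

/-- for a permutation, the image of a complement is the complement of the image. [folklore] -/
theorem image_compl_perm (σ : Equiv.Perm (Fin m)) (C : Finset (Fin m)) : Cᶜ.image σ = (C.image σ)ᶜ := by
  classical
  ext x
  simp only [mem_image, mem_compl]
  constructor
  · rintro ⟨i, hi, rfl⟩ ⟨j, hj, hji⟩
    exact hi (σ.injective hji ▸ hj)
  · intro h
    refine ⟨σ.symm x, fun hx => h ⟨σ.symm x, hx, σ.apply_symm_apply x⟩, σ.apply_symm_apply x⟩

/-- **LAYER-BOUNDARY LAW.**  `q` dominant at `θa`, `r` dominant at `θb > θa` and PURE over `l⋆`; `C` admissible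
(`C.image σ_q = C.image σ_r`) and the two terms differ somewhere on `C`.  Then the `l⋆`-count of `r` on `C` strictly exceeds
that of `q` on `C`. [folklore] -/
theorem topCount_lt_of_swap_pure (d : Fin K → ℕ) (v ε : Fin m → Fin m → Fin K → ℤ) {θa θb : ℤ} (hab : θa < θb)
    {q r : Equiv.Perm (Fin m) × (Fin m → Fin K)} (hq : IsDominant d v ε θa q) (hr : IsDominant d v ε θb r)
    (lstar : Fin K) (hpure : ∀ i : Fin m, r.2 i = lstar ∨ d (r.2 i) = 0)
    (C : Finset (Fin m)) (hC : C.image q.1 = C.image r.1)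
    (hdiff : ∃ i ∈ C, (q.1 i, q.2 i) ≠ (r.1 i, r.2 i)) :
    (C.filter fun i => q.2 i = lstar).card < (C.filter fun i => r.2 i = lstar).card := by
  classical
  have hlt := sum_lt_sum_of_swap d v ε hab hq hr C hC hdiff
  have hlo := mul_topCount_le_sum d lstar q C
  rw [sum_eq_mul_topCount_of_pure d lstar r hpure C] at hlt
  have h := lt_of_le_of_lt hlo hlt
  have hd : (0 : ℤ) ≤ (d lstar : ℤ) := by exact_mod_cast Nat.zero_le _
  exact_mod_cast Int.lt_of_mul_lt_mul_left h hd

/-- **Shared positions.**  Under the same hypotheses, at a column where `q` and `r` use the SAME ROW, either they agree (same class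
too) or `r` carries `l⋆` there and `q` does not. [folklore] -/
theorem sameRow_eq_or_top_of_pure (d : Fin K → ℕ) (v ε : Fin m → Fin m → Fin K → ℤ) {θa θb : ℤ} (hab : θa < θb)
    {q r : Equiv.Perm (Fin m) × (Fin m → Fin K)} (hq : IsDominant d v ε θa q) (hr : IsDominant d v ε θb r)
    (lstar : Fin K) (hpure : ∀ i : Fin m, r.2 i = lstar ∨ d (r.2 i) = 0) (i : Fin m) (hrow : q.1 i = r.1 i) :
    q.2 i = r.2 i ∨ (r.2 i = lstar ∧ q.2 i ≠ lstar) := by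
  classical
  by_cases h : q.2 i = r.2 i
  · exact Or.inl h
  · right
    have hC : ({i} : Finset (Fin m)).image q.1 = ({i} : Finset (Fin m)).image r.1 := by
      rw [image_singleton, image_singleton, hrow]
    have hdiff : ∃ j ∈ ({i} : Finset (Fin m)), (q.1 j, q.2 j) ≠ (r.1 j, r.2 j) :=
      ⟨i, mem_singleton_self i, fun hh => h ((Prod.mk.injEq _ _ _ _).mp hh).2⟩
    have hlt := topCount_lt_of_swap_pure d v ε hab hq hr lstar hpure {i} hC hdiff
    have hr' : r.2 i = lstar := by
      by_contra hne
      have : (({i} : Finset (Fin m)).filter fun j => r.2 j = lstar).card = 0 := by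
        rw [card_eq_zero, filter_singleton, if_neg hne]
      omega
    have hq' : q.2 i ≠ lstar := by
      intro hqe
      have : (({i} : Finset (Fin m)).filter fun j => q.2 j = lstar).card = 1 := by
        rw [filter_singleton, if_pos hqe, card_singleton]
      have h2 : (({i} : Finset (Fin m)).filter fun j => r.2 j = lstar).card ≤ 1 :=
        (card_filter_le _ _).trans (card_singleton i).le
      omega
    exact ⟨hr', hq'⟩

/-- **Single-component form.**  If moreover the TOTAL `l⋆`-count of `r` exceeds that of `q` by at most one, there are no two
DISJOINT admissible column sets on each of which `q` and `r` differ (each would gain an `l⋆`-entry, and so would their union: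
`2 ≤` gain on `C₁ ∪ C₂ ≤` total gain `≤ 1`). [folklore] -/
theorem not_two_disjoint_swaps_of_pure (d : Fin K → ℕ) (v ε : Fin m → Fin m → Fin K → ℤ) {θa θb : ℤ} (hab : θa < θb)
    {q r : Equiv.Perm (Fin m) × (Fin m → Fin K)} (hq : IsDominant d v ε θa q) (hr : IsDominant d v ε θb r)
    (lstar : Fin K) (hpure : ∀ i : Fin m, r.2 i = lstar ∨ d (r.2 i) = 0)
    (htot : (univ.filter fun i => r.2 i = lstar).card ≤ (univ.filter fun i => q.2 i = lstar).card + 1)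
    (C₁ C₂ : Finset (Fin m)) (hdisj : Disjoint C₁ C₂)
    (hC₁ : C₁.image q.1 = C₁.image r.1) (hC₂ : C₂.image q.1 = C₂.image r.1)
    (hdiff₁ : ∃ i ∈ C₁, (q.1 i, q.2 i) ≠ (r.1 i, r.2 i)) (hdiff₂ : ∃ i ∈ C₂, (q.1 i, q.2 i) ≠ (r.1 i, r.2 i)) : False := by
  classical
  have h1 := topCount_lt_of_swap_pure d v ε hab hq hr lstar hpure C₁ hC₁ hdiff₁
  have h2 := topCount_lt_of_swap_pure d v ε hab hq hr lstar hpure C₂ hC₂ hdiff₂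
  -- the complement of `C₁ ∪ C₂` is admissible as well, hence does not lose `l⋆`-entries
  set C₃ : Finset (Fin m) := (C₁ ∪ C₂)ᶜ with hC₃
  have hU : (C₁ ∪ C₂).image q.1 = (C₁ ∪ C₂).image r.1 := by
    rw [image_union, image_union, hC₁, hC₂]
  have hC₃adm : C₃.image q.1 = C₃.image r.1 := by
    -- images of complements are complements of images for permutations
    rw [hC₃, image_compl_perm q.1, image_compl_perm r.1, hU]
  have h3 : (C₃.filter fun i => q.2 i = lstar).card ≤ (C₃.filter fun i => r.2 i = lstar).card := by
    by_cases hd3 : ∃ i ∈ C₃, (q.1 i, q.2 i) ≠ (r.1 i, r.2 i)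
    · exact (topCount_lt_of_swap_pure d v ε hab hq hr lstar hpure C₃ hC₃adm hd3).le
    · push Not at hd3
      refine le_of_eq (congrArg Finset.card (filter_congr fun i hi => ?_))
      rw [((Prod.mk.injEq _ _ _ _).mp (hd3 i hi)).2]
  -- split the total counts along `C₁`, `C₂`, `C₃`
  have hsplit : ∀ (p : Equiv.Perm (Fin m) × (Fin m → Fin K)),
      (univ.filter fun i => p.2 i = lstar).card
        = (C₁.filter fun i => p.2 i = lstar).card + (C₂.filter fun i => p.2 i = lstar).card
          + (C₃.filter fun i => p.2 i = lstar).card := by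
    intro p
    have e1 : (univ : Finset (Fin m)) = (C₁ ∪ C₂) ∪ C₃ := by
      rw [hC₃, union_compl]
    rw [e1, filter_union, filter_union,
      card_union_of_disjoint, card_union_of_disjoint]
    · exact disjoint_filter_filter hdisj
    · rw [← filter_union]
      exact disjoint_filter_filter (hC₃ ▸ disjoint_compl_right)
  have hq' := hsplit q
  have hr' := hsplit r
  omega

/-- Chain form of `topCount_lt_of_swap_pure`. [folklore] -/
theorem topCount_lt_of_swap_pure_chain (d : Fin K → ℕ) (v ε : Fin m → Fin m → Fin K → ℤ) {n : ℕ}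
    (θ : Fin (n + 1) → ℤ) (p : Fin (n + 1) → Equiv.Perm (Fin m) × (Fin m → Fin K)) (hθ : StrictMono θ)
    (hdom : ∀ k, IsDominant d v ε (θ k) (p k)) {u w : Fin (n + 1)} (huw : u < w)
    (lstar : Fin K) (hpure : ∀ i : Fin m, (p w).2 i = lstar ∨ d ((p w).2 i) = 0)
    (C : Finset (Fin m)) (hC : C.image (p u).1 = C.image (p w).1)
    (hdiff : ∃ i ∈ C, ((p u).1 i, (p u).2 i) ≠ ((p w).1 i, (p w).2 i)) :
    (C.filter fun i => (p u).2 i = lstar).card < (C.filter fun i => (p w).2 i = lstar).card :=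
  topCount_lt_of_swap_pure d v ε (hθ huw) (hdom u) (hdom w) lstar hpure C hC hdiff

/-- Chain form of `not_two_disjoint_swaps_of_pure`. [folklore] -/
theorem not_two_disjoint_swaps_of_pure_chain (d : Fin K → ℕ) (v ε : Fin m → Fin m → Fin K → ℤ) {n : ℕ}
    (θ : Fin (n + 1) → ℤ) (p : Fin (n + 1) → Equiv.Perm (Fin m) × (Fin m → Fin K)) (hθ : StrictMono θ)
    (hdom : ∀ k, IsDominant d v ε (θ k) (p k)) {u w : Fin (n + 1)} (huw : u < w)
    (lstar : Fin K) (hpure : ∀ i : Fin m, (p w).2 i = lstar ∨ d ((p w).2 i) = 0)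
    (htot : (univ.filter fun i => (p w).2 i = lstar).card ≤ (univ.filter fun i => (p u).2 i = lstar).card + 1)
    (C₁ C₂ : Finset (Fin m)) (hdisj : Disjoint C₁ C₂)
    (hC₁ : C₁.image (p u).1 = C₁.image (p w).1) (hC₂ : C₂.image (p u).1 = C₂.image (p w).1)
    (hdiff₁ : ∃ i ∈ C₁, ((p u).1 i, (p u).2 i) ≠ ((p w).1 i, (p w).2 i))
    (hdiff₂ : ∃ i ∈ C₂, ((p u).1 i, (p u).2 i) ≠ ((p w).1 i, (p w).2 i)) : False :=
  not_two_disjoint_swaps_of_pure d v ε (hθ huw) (hdom u) (hdom w) lstar hpure htot C₁ C₂ hdisj hC₁ hC₂ hdiff₁ hdiff₂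

end LayerBoundary

end Summit.ValiantsHypothesis.ValiantsHypothesis.Theorems.LacunarySymmetroidMatrixDescartes.TropicalCensus
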